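import Summits.Ventures.Crystal3D.TopCut.T13c2593Agg1

/-!
# T13(arccos(2593/5000)): A(3, 2593/5000) ≤ 12: kernel validation of Gram blocks R0, R1, R2 (chunk theorems okR0_5, okR1_1, okR1_2, okR2_1; cost proxy 0.29 Gbit)

HONEST FRAMING: generated data / kernel-validation file of the venture `Crystal3D` (cell `pub-crystal3d`,
phase 2, seat p2): one piece of the kernel replay of an EXACT Bachoc–Vallentin three-point certificate on `S²`
(n = 3, s = 2593/5000, degree d = 8, Bachoc–Vallentin multiplier set) proving `A(3, s) ≤ 12` — the
"SDP top cut" `T13(arccos s)` of the sticky-sphere programme (no 13 unit vectors of `ℝ³` pairwise `≥ arccos s` apart).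
Source certificate: `cert_d8N8_c2593over5000_j175130.json` (pub-crystal3d phase2/sdp-topcut, p2 g6: CLARABEL float solve → rational
rounding → exact verification ×2, verify_bv + theory-2 verify2), converted by `cert2lean_p2.py` (an input adapter of
pub-packcert-sdp `cert2lean_s2.py`) into the integer units of the EXISTING tree checker of the venture `PackingBounds`
(cell `pub-packcert`): `ThreePointCert.Check` + `CheckDim3` + `CheckSym2` (soundness `SoundDim3.card_le_of_cert33S2`),
Gram factors offset-encoded for the Kronecker-packed chunk validation `ThreePointCert.CheckKron`; file layout of their
emitter `emitleanS2.py` (Leaf / Agg / Expand / Proof). Nothing geometric is proved in this file; plain lists of integers /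
monomials and `decide +kernel` facts about them (standard axioms only, no `native_decide`).
-/

namespace Summit.Ventures.Crystal3D.TopCut.T13c2593

open Literature.Geometry.DiscreteGeometry Literature.Geometry.DiscreteGeometry.PolyCert PolyCert.SPoly
open Summit.Ventures.PackingBounds.ThreePointCert

set_option maxRecDepth 100000 in
set_option maxHeartbeats 0 in
/-- Block `R0`: rows from 152 ((T13c2593.gR0K.z.length - 152) rows) of `zᵀ(LLᵀ)z` added to `dR0c4` give `eR0` (kernel, Kronecker-packed chunk check). -/
theorem okR0_5 : chunkOKK T13c2593.gR0K 152 (T13c2593.gR0K.z.length - 152) T13c2593.dR0c4 T13c2593.eR0 = true := by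
  decide +kernel

set_option maxRecDepth 100000 in
set_option maxHeartbeats 0 in
/-- Block `R1`: rows from 0 (93 rows) of `zᵀ(LLᵀ)z` added to `[]` give `dR1c1` (kernel, Kronecker-packed chunk check). -/
theorem okR1_1 : chunkOKK T13c2593.gR1K 0 93 [] T13c2593.dR1c1 = true := by
  decide +kernel

set_option maxRecDepth 100000 in
set_option maxHeartbeats 0 in
/-- Block `R1`: rows from 93 ((T13c2593.gR1K.z.length - 93) rows) of `zᵀ(LLᵀ)z` added to `dR1c1` give `eR1` (kernel, Kronecker-packed chunk check). -/
theorem okR1_2 : chunkOKK T13c2593.gR1K 93 (T13c2593.gR1K.z.length - 93) T13c2593.dR1c1 T13c2593.eR1 = true := by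
  decide +kernel

set_option maxRecDepth 100000 in
set_option maxHeartbeats 0 in
/-- Block `R2`: rows from 0 (T13c2593.gR2K.z.length rows) of `zᵀ(LLᵀ)z` added to `[]` give `eR2` (kernel, Kronecker-packed chunk check). -/
theorem okR2_1 : chunkOKK T13c2593.gR2K 0 T13c2593.gR2K.z.length [] T13c2593.eR2 = true := by
  decide +kernel

end Summit.Ventures.Crystal3D.TopCut.T13c2593
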